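import Mathlib
import Summits.Ventures.PercRepro2.RowC1DetHFresh
import Summits.Ventures.PercRepro2.RowC1Star

/-!
# Fresh-graph tools for the attraction sign of (★) (blind cell PercRepro2, p2 g32; proofs/P2-G32-STAR.md §7)

Part I of `RowC1OHN.lean`: configurations with the edges at a vertex set closed (`delConfig_delConfig`,
`delConfig_anti_set`), connections of a vertex outside a set closed under open adjacency
(`conn_delConfig_iff_of_closed`), the fresh invariance of the `G − o` cluster of `a₂` on `{a₂ ∉ C(a₁)}`
(`cluster_delO_delConfig_cluster`), a **tower identity for events decided in the fresh graph**
(`prob_clusterIn_inter_fresh_eq_expect`), the event `K2ev = {b ∈ C_{G−o}(a₂)}` (= `connDelEvent`),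
the four events `{Q, o ∈ H (, b ∈ K₂)}`, `{Q, o rootless (, b ∈ K₂)}` as fresh exploration events, and the
fresh probabilities `delProb` with Harris in `G ∖ W` (`delProb_mul_le`) and their antitonicity.  Std axioms.
-/
namespace Summit.Ventures.PercRepro2

namespace RowC1

section OHN

open Classical

variable {V : Type*} {E : Type*} [Fintype E] [DecidableEq E] [Fintype V] [DecidableEq V]
  {R : Type*} [CommRing R] [LinearOrder R] [IsStrictOrderedRing R]

/-! ### Configurations with the edges at a set closed: commutation and monotonicity -/

omit [Fintype E] [DecidableEq E] [Fintype V] [DecidableEq V] in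
/-- Closing the edges at `W` and then at `S` is closing the edges at `W ∪ S`. -/
lemma delConfig_delConfig (ends : E → Sym2 V) (W S : Set V) (ω : Config E) :
    delConfig ends S (delConfig ends W ω) = delConfig ends (W ∪ S) ω := by
  funext e
  by_cases hS : e ∈ touches ends S
  · rw [delConfig_apply_of_mem hS, delConfig_apply_of_mem (W := W ∪ S)]
    obtain ⟨x, hx, y, hxy⟩ := hS
    exact ⟨x, Or.inr hx, y, hxy⟩
  · rw [delConfig_apply_of_notMem hS]
    by_cases hW : e ∈ touches ends W
    · rw [delConfig_apply_of_mem hW, delConfig_apply_of_mem (W := W ∪ S)]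
      obtain ⟨x, hx, y, hxy⟩ := hW
      exact ⟨x, Or.inl hx, y, hxy⟩
    · rw [delConfig_apply_of_notMem hW, delConfig_apply_of_notMem]
      rintro ⟨x, hx, y, hxy⟩
      rcases hx with hx | hx
      · exact hW ⟨x, hx, y, hxy⟩
      · exact hS ⟨x, hx, y, hxy⟩

omit [Fintype E] [DecidableEq E] [Fintype V] [DecidableEq V] in
/-- `delConfig ends W ω ≤ ω`. -/
lemma delConfig_le_self (ends : E → Sym2 V) (W : Set V) (ω : Config E) : delConfig ends W ω ≤ ω := by
  intro e
  by_cases h : e ∈ touches ends W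
  · rw [delConfig_apply_of_mem h]
    exact Bool.false_le _
  · rw [delConfig_apply_of_notMem h]

omit [Fintype E] [DecidableEq E] [Fintype V] [DecidableEq V] in
/-- Closing more vertices gives a smaller configuration. -/
lemma delConfig_anti_set (ends : E → Sym2 V) {W W' : Set V} (h : W ⊆ W') (ω : Config E) :
    delConfig ends W' ω ≤ delConfig ends W ω := by
  intro e
  by_cases h' : e ∈ touches ends W'
  · rw [delConfig_apply_of_mem h']
    exact Bool.false_le _
  · have hW : e ∉ touches ends W := fun ⟨x, hx, y, hxy⟩ => h' ⟨x, h hx, y, hxy⟩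
    rw [delConfig_apply_of_notMem h', delConfig_apply_of_notMem hW]

/-! ### Connections of a vertex outside a set closed under open adjacency -/

omit [Fintype E] [DecidableEq E] [Fintype V] [DecidableEq V] in
/-- If `S` is closed under the open adjacency of `ω` and `u ∉ S`, closing the edges at `S` does not
change the connections of `u` (generalises `conn_restrict_iff_of_cluster_eq`). -/
lemma conn_delConfig_iff_of_closed {ends : E → Sym2 V} {ω : Config E} {S : Set V}
    (hS : ∀ x ∈ S, ∀ y, (openGraph ends ω).Adj x y → y ∈ S) {u w : V} (hu : u ∉ S) :
    Conn ends (delConfig ends S ω) u w ↔ Conn ends ω u w := by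
  constructor
  · exact conn_mono (delConfig_le_self ends S ω)
  · intro h
    have key : w ∈ {x | x ∉ S ∧ Conn ends (delConfig ends S ω) u x} := by
      refine mem_of_conn_of_closed (ends := ends) (ω := ω) ?_ ⟨hu, conn_refl _ _ _⟩ h
      rintro x ⟨hxS, hxc⟩ y hxy
      obtain ⟨hne, e, he, hends⟩ := openGraph_adj.1 hxy
      have hyS : y ∉ S := fun hy => hxS (hS y hy x (openGraph_adj.2 ⟨hne.symm, e, he, by
        rw [hends, Sym2.eq_swap]⟩))
      have hnt : e ∉ touches ends S := by
        rintro ⟨x', hx', y', hends'⟩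
        rw [hends, Sym2.eq_iff] at hends'
        rcases hends' with ⟨rfl, _⟩ | ⟨_, rfl⟩
        · exact hxS hx'
        · exact hyS hx'
      refine ⟨hyS, conn_trans hxc (SimpleGraph.Adj.reachable (openGraph_adj.2 ⟨hne, e, ?_, hends⟩))⟩
      rw [delConfig_apply_of_notMem hnt]
      exact he
    exact key.2

omit [Fintype E] [DecidableEq E] [Fintype V] [DecidableEq V] in
/-- The cluster of `a₁` is closed under the open adjacency of any `ω' ≤ ω`. -/
lemma cluster_closed_of_le {ends : E → Sym2 V} {ω ω' : Config E} (h : ω' ≤ ω) (a₁ : V) :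
    ∀ x ∈ cluster ends ω a₁, ∀ y, (openGraph ends ω').Adj x y → y ∈ cluster ends ω a₁ := by
  intro x hx y hxy
  obtain ⟨hne, e, he, hends⟩ := openGraph_adj.1 hxy
  have he' : ω e = true := Bool.le_iff_imp.1 (h e) he
  exact conn_trans hx (SimpleGraph.Adj.reachable (openGraph_adj.2 ⟨hne, e, he', hends⟩))

omit [Fintype E] [DecidableEq E] [Fintype V] [DecidableEq V] in
/-- **The `G − o` cluster of `a₂` is decided in the fresh graph**: on `{a₂ ∉ C(a₁)}`,
`C_{G−o}(a₂)` computed after closing the edges at `C(a₁)` is `C_{G−o}(a₂)`. -/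
lemma cluster_delO_delConfig_cluster {ends : E → Sym2 V} {ω : Config E} {a₁ a₂ : V} (S : Set V)
    (h : a₂ ∉ cluster ends ω a₁) :
    cluster ends (delConfig ends S (delConfig ends (cluster ends ω a₁) ω)) a₂ =
      cluster ends (delConfig ends S ω) a₂ := by
  rw [delConfig_delConfig, Set.union_comm, ← delConfig_delConfig]
  ext w
  simp only [mem_cluster]
  exact conn_delConfig_iff_of_closed (cluster_closed_of_le (delConfig_le_self ends S ω) a₁) h

/-! ### A tower identity for events decided in the fresh graph -/

/-- `P(A in G ∖ W)`: the probability that the configuration with the edges at `W` closed lies in `A`. -/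
noncomputable def delProb (p : E → R) (ends : E → Sym2 V) (A : Set (Config E)) (W : Set V) : R :=
  prob p {ω | delConfig ends W ω ∈ A}

omit [DecidableEq V] [LinearOrder R] [IsStrictOrderedRing R] in
/-- **Exploring the cluster of `s`, fresh-event form**: if the event `A` is decided in the fresh
graph on `{t ∉ C(s)}` (`ω ∈ A ↔ delConfig (C(s)) ω ∈ A`), then
`P(C(s) ∈ 𝓤, A, s ↮ t) = E[1_𝓤(C(s)) · delProb A (C(s)) · 1_{s↮t}]`. -/
theorem prob_clusterIn_inter_fresh_eq_expect (p : E → R) (ends : E → Sym2 V) (s t : V)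
    (𝓤 : Set (Set V)) (A : Set (Config E))
    (hA : ∀ ω, t ∉ cluster ends ω s → (ω ∈ A ↔ delConfig ends (cluster ends ω s) ω ∈ A)) :
    prob p (clusterInEvent ends s 𝓤 ∩ A ∩ (connEvent ends s t)ᶜ) =
      expect p (fun ω => 𝓤.indicator 1 (cluster ends ω s) *
        delProb p ends A (cluster ends ω s) * ((connEvent ends s t)ᶜ).indicator 1 ω) := by
  classical
  let c : Set V → R := fun W => 𝓤.indicator 1 W * ({W' : Set V | t ∉ W'}.indicator 1 W)
  let D : Set V → Config E → R := fun W => ({ω | delConfig ends W ω ∈ A} : Set (Config E)).indicator 1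
  let Φ : Set V → Config E → R := fun W ω => c W * D W ω
  have hΦ : ∀ W, DependsOn (Φ W) (touches ends W)ᶜ := by
    intro W ω ω' h
    simp only [Φ, D]
    congr 1
    refine dependsOn_indicator (R := R) (fun ω ω' h => ?_) h
    show (delConfig ends W ω ∈ A) = (delConfig ends W ω' ∈ A)
    rw [delConfig_congr h]
  have hS : ∀ W : Set V, DependsOn (· ∈ {ω | cluster ends ω s = W}) (touches ends W) :=
    fun W => dependsOn_clusterEvent ends s W
  have hdisj : ∀ W : Set V, Disjoint (touches ends W) (touches ends W)ᶜ :=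
    fun W => disjoint_compl_right
  have hpt : ∀ ω, (clusterInEvent ends s 𝓤 ∩ A ∩
      (connEvent ends s t)ᶜ).indicator (1 : Config E → R) ω = Φ (cluster ends ω s) ω := by
    intro ω
    simp only [Φ, c, D]
    by_cases hst : t ∈ cluster ends ω s
    · have h1 : ω ∉ clusterInEvent ends s 𝓤 ∩ A ∩ (connEvent ends s t)ᶜ := fun h => h.2 hst
      rw [Set.indicator_of_notMem h1,
        Set.indicator_of_notMem (show cluster ends ω s ∉ {W' : Set V | t ∉ W'} from fun h => h hst)]
      simp
    · have hmem : ω ∈ {ω' | delConfig ends (cluster ends ω s) ω' ∈ A} ↔ ω ∈ A := by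
        rw [Set.mem_setOf_eq]
        exact (hA ω hst).symm
      rw [Set.indicator_of_mem (show cluster ends ω s ∈ {W' : Set V | t ∉ W'} from hst)]
      by_cases h𝓤 : cluster ends ω s ∈ 𝓤
      · rw [Set.indicator_of_mem h𝓤]
        by_cases hA' : ω ∈ A
        · rw [Set.indicator_of_mem (show ω ∈ clusterInEvent ends s 𝓤 ∩ A ∩
              (connEvent ends s t)ᶜ from ⟨⟨h𝓤, hA'⟩, hst⟩), Set.indicator_of_mem (hmem.2 hA')]
          simp
        · rw [Set.indicator_of_notMem (show ω ∉ clusterInEvent ends s 𝓤 ∩ A ∩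
              (connEvent ends s t)ᶜ from fun h => hA' h.1.2),
            Set.indicator_of_notMem (fun h => hA' (hmem.1 h))]
          simp
      · rw [Set.indicator_of_notMem (show ω ∉ clusterInEvent ends s 𝓤 ∩ A ∩
            (connEvent ends s t)ᶜ from fun h => h𝓤 h.1.1), Set.indicator_of_notMem h𝓤]
        simp
  have hΦexp : ∀ W, expect p (Φ W) = c W * delProb p ends A W := by
    intro W
    simp only [Φ, D]
    rw [expect_const_mul, ← prob_eq_expect_indicator]
    rfl
  rw [prob_eq_expect_indicator]
  have e1 : (clusterInEvent ends s 𝓤 ∩ A ∩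
      (connEvent ends s t)ᶜ).indicator (1 : Config E → R) = fun ω => Φ (cluster ends ω s) ω :=
    funext hpt
  rw [e1, expect_tower p hdisj (S := fun ω => cluster ends ω s) hS hΦ]
  simp only [hΦexp]
  unfold expect
  refine Finset.sum_congr rfl fun ω _ => ?_
  simp only [c]
  by_cases hst : t ∈ cluster ends ω s
  · rw [Set.indicator_of_notMem (show cluster ends ω s ∉ {W' : Set V | t ∉ W'} from fun h => h hst),
      Set.indicator_of_notMem (show ω ∉ (connEvent ends s t)ᶜ from fun h => h hst)]
    simp
  · rw [Set.indicator_of_mem (show cluster ends ω s ∈ {W' : Set V | t ∉ W'} from hst),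
      Set.indicator_of_mem (show ω ∈ (connEvent ends s t)ᶜ from hst)]
    simp

/-! ### The event `b ∈ C_{G−o}(a₂)` and the four events as fresh exploration events -/

/-- `{b ∈ C_{G−o}(a₂)}` in the instance-free form. -/
def K2ev (ends : E → Sym2 V) (a₂ o b : V) : Set (Config E) :=
  {ω | b ∈ cluster ends (delConfig ends (↑({o} : Finset V) : Set V) ω) a₂}

omit [Fintype E] [DecidableEq E] in
/-- `connDelEvent ends {o} b a₂ = K2ev`. -/
lemma connDelEvent_eq_K2ev (ends : E → Sym2 V) (a₂ o b : V) :
    connDelEvent ends {o} b a₂ = K2ev ends a₂ o b := by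
  ext ω
  simp only [connDelEvent, K2ev, Set.mem_setOf_eq, mem_cluster]
  rw [delConfig_eq_restrict]
  exact ⟨conn_symm, conn_symm⟩

omit [Fintype E] [DecidableEq E] [Fintype V] [DecidableEq V] in
/-- `K2ev` is increasing. -/
lemma isUpperSet_K2ev (ends : E → Sym2 V) (a₂ o b : V) : IsUpperSet (K2ev ends a₂ o b) :=
  fun _ _ h hb => cluster_mono (BHKPair.delConfig_mono_config ends _ h) a₂ hb

omit [Fintype E] [DecidableEq E] [Fintype V] [DecidableEq V] in
/-- On `{a₂ ∉ C(a₁)}`, `{o ∈ C(a₂)}` is decided in the fresh graph. -/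
lemma fresh_oH {ends : E → Sym2 V} {ω : Config E} {a₁ a₂ o : V} (h : a₂ ∉ cluster ends ω a₁) :
    ω ∈ connEvent ends a₂ o ↔ delConfig ends (cluster ends ω a₁) ω ∈ connEvent ends a₂ o := by
  show o ∈ cluster ends ω a₂ ↔ o ∈ cluster ends (delConfig ends (cluster ends ω a₁) ω) a₂
  rw [cluster_delConfig_cluster h]

omit [Fintype E] [DecidableEq E] [Fintype V] [DecidableEq V] in
/-- On `{a₂ ∉ C(a₁)}`, `{b ∈ C_{G−o}(a₂)}` is decided in the fresh graph. -/
lemma fresh_K2 {ends : E → Sym2 V} {ω : Config E} {a₁ a₂ o b : V} (h : a₂ ∉ cluster ends ω a₁) :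
    ω ∈ K2ev ends a₂ o b ↔ delConfig ends (cluster ends ω a₁) ω ∈ K2ev ends a₂ o b := by
  show b ∈ cluster ends (delConfig ends (↑({o} : Finset V) : Set V) ω) a₂ ↔
    b ∈ cluster ends (delConfig ends (↑({o} : Finset V) : Set V)
      (delConfig ends (cluster ends ω a₁) ω)) a₂
  rw [cluster_delO_delConfig_cluster _ h]

omit [Fintype E] [DecidableEq E] [Fintype V] [DecidableEq V] in
/-- `{Q, o ∈ H}`: `o ∉ C(a₁)`. -/
lemma notMem_cluster_a₁_of_oH {ends : E → Sym2 V} {ω : Config E} {a₁ a₂ o : V}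
    (hQ : ω ∈ (connEvent ends a₁ a₂)ᶜ) (ho : ω ∈ connEvent ends a₂ o) : cluster ends ω a₁ ∈ {C : Set V | o ∉ C} :=
  fun h => hQ (conn_trans h (conn_symm ho))

omit [Fintype E] [DecidableEq E] in
/-- `{Q, o ∈ H, b ∈ K₂}` as a fresh exploration event. -/
lemma ev_oH_K2 (ends : E → Sym2 V) (a₁ a₂ o b : V) :
    connEvent ends a₂ o ∩ connDelEvent ends {o} b a₂ ∩ (connEvent ends a₁ a₂)ᶜ =
      clusterInEvent ends a₁ ({C : Set V | o ∉ C}) ∩ (connEvent ends a₂ o ∩ K2ev ends a₂ o b) ∩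
        (connEvent ends a₁ a₂)ᶜ := by
  rw [connDelEvent_eq_K2ev]
  ext ω
  constructor
  · rintro ⟨⟨ho, hb⟩, hQ⟩
    exact ⟨⟨notMem_cluster_a₁_of_oH hQ ho, ⟨ho, hb⟩⟩, hQ⟩
  · rintro ⟨⟨_, ⟨ho, hb⟩⟩, hQ⟩
    exact ⟨⟨ho, hb⟩, hQ⟩

omit [Fintype E] [DecidableEq E] [Fintype V] [DecidableEq V] in
/-- `{Q, o ∈ H}` as a fresh exploration event. -/
lemma ev_oH (ends : E → Sym2 V) (a₁ a₂ o : V) :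
    connEvent ends a₂ o ∩ (connEvent ends a₁ a₂)ᶜ =
      clusterInEvent ends a₁ ({C : Set V | o ∉ C}) ∩ connEvent ends a₂ o ∩ (connEvent ends a₁ a₂)ᶜ := by
  ext ω
  constructor
  · rintro ⟨ho, hQ⟩
    exact ⟨⟨notMem_cluster_a₁_of_oH hQ ho, ho⟩, hQ⟩
  · rintro ⟨⟨_, ho⟩, hQ⟩
    exact ⟨ho, hQ⟩

omit [Fintype E] [DecidableEq E] [Fintype V] [DecidableEq V] in
/-- `{Q, o rootless}` as a fresh exploration event. -/
lemma ev_oN' (ends : E → Sym2 V) (a₁ a₂ o : V) :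
    (connEvent ends a₁ o ∪ connEvent ends a₂ o)ᶜ ∩ (connEvent ends a₁ a₂)ᶜ =
      clusterInEvent ends a₁ ({C : Set V | o ∉ C}) ∩ (connEvent ends a₂ o)ᶜ ∩ (connEvent ends a₁ a₂)ᶜ := by
  ext ω
  simp only [Set.mem_inter_iff, Set.mem_compl_iff, Set.mem_union, not_or, mem_clusterInEvent]
  constructor
  · rintro ⟨⟨h1, h2⟩, hQ⟩
    exact ⟨⟨h1, h2⟩, hQ⟩
  · rintro ⟨⟨h1, h2⟩, hQ⟩
    exact ⟨⟨h1, h2⟩, hQ⟩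

omit [Fintype E] [DecidableEq E] in
/-- `{Q, o rootless, b ∈ K₂}` as a fresh exploration event. -/
lemma ev_oN_K2' (ends : E → Sym2 V) (a₁ a₂ o b : V) :
    (connEvent ends a₁ o ∪ connEvent ends a₂ o)ᶜ ∩ connDelEvent ends {o} b a₂ ∩
        (connEvent ends a₁ a₂)ᶜ =
      clusterInEvent ends a₁ ({C : Set V | o ∉ C}) ∩ ((connEvent ends a₂ o)ᶜ ∩ K2ev ends a₂ o b) ∩
        (connEvent ends a₁ a₂)ᶜ := by
  rw [connDelEvent_eq_K2ev]
  ext ω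
  simp only [Set.mem_inter_iff, Set.mem_compl_iff, Set.mem_union, not_or, mem_clusterInEvent]
  constructor
  · rintro ⟨⟨⟨h1, h2⟩, hb⟩, hQ⟩
    exact ⟨⟨h1, ⟨h2, hb⟩⟩, hQ⟩
  · rintro ⟨⟨h1, ⟨h2, hb⟩⟩, hQ⟩
    exact ⟨⟨⟨h1, h2⟩, hb⟩, hQ⟩

/-! ### The fresh probabilities `g`, `π`, `κ₀`, `κ₁` -/

omit [Fintype V] [DecidableEq V] [LinearOrder R] [IsStrictOrderedRing R] in
/-- `delProb` of a complement. -/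
lemma delProb_compl (p : E → R) (ends : E → Sym2 V) (A : Set (Config E)) (W : Set V) :
    delProb p ends Aᶜ W = 1 - delProb p ends A W := by
  unfold delProb
  rw [← prob_compl]
  rfl

omit [Fintype V] [DecidableEq V] [LinearOrder R] [IsStrictOrderedRing R] in
/-- `delProb` of an intersection with a complement. -/
lemma delProb_inter_compl_add (p : E → R) (ends : E → Sym2 V) (A B : Set (Config E)) (W : Set V) :
    delProb p ends (A ∩ B) W + delProb p ends (Aᶜ ∩ B) W = delProb p ends B W := by
  unfold delProb
  have e1 : ({ω | delConfig ends W ω ∈ A ∩ B} : Set (Config E)) =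
      {ω | delConfig ends W ω ∈ B} ∩ {ω | delConfig ends W ω ∈ A} := by
    ext ω; exact ⟨fun h => ⟨h.2, h.1⟩, fun h => ⟨h.2, h.1⟩⟩
  have e2 : ({ω | delConfig ends W ω ∈ Aᶜ ∩ B} : Set (Config E)) =
      {ω | delConfig ends W ω ∈ B} ∩ {ω | delConfig ends W ω ∈ A}ᶜ := by
    ext ω; exact ⟨fun h => ⟨h.2, h.1⟩, fun h => ⟨h.2, h.1⟩⟩
  rw [e1, e2]
  exact prob_inter_add_prob_inter_compl p _ _

omit [Fintype V] [DecidableEq V] in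
/-- **Harris in `G ∖ W`**: for increasing `A, B`, `delProb A W · delProb B W ≤ delProb (A ∩ B) W`. -/
lemma delProb_mul_le (p : E → R) (hp : IsProbVec p) (ends : E → Sym2 V) {A B : Set (Config E)}
    (hA : IsUpperSet A) (hB : IsUpperSet B) (W : Set V) :
    delProb p ends A W * delProb p ends B W ≤ delProb p ends (A ∩ B) W := by
  unfold delProb
  have e : ({ω | delConfig ends W ω ∈ A ∩ B} : Set (Config E)) =
      {ω | delConfig ends W ω ∈ A} ∩ {ω | delConfig ends W ω ∈ B} := by
    ext ω; exact Iff.rfl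
  rw [e]
  exact prob_mul_prob_le_prob_inter hp
    (fun ω ω' h hω => hA (BHKPair.delConfig_mono_config ends W h) hω)
    (fun ω ω' h hω => hB (BHKPair.delConfig_mono_config ends W h) hω)

omit [Fintype V] [DecidableEq V] in
/-- `g(W) = P_{G∖W}(o ∈ C(a₂))` is antitone. -/
lemma delProb_oH_anti (p : E → R) (hp : IsProbVec p) (ends : E → Sym2 V) (a₂ o : V) :
    Antitone (delProb p ends (connEvent ends a₂ o)) := by
  have : delProb p ends (connEvent ends a₂ o) = delClusterProb p ends a₂ {C : Set V | o ∈ C} := by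
    funext W; rfl
  rw [this]
  exact delClusterProb_anti p hp ends a₂ (fun _ _ h hx => h hx)

omit [Fintype V] [DecidableEq V] in
/-- `π(W) = P_{G∖W}(b ∈ C_{G−o}(a₂))` is antitone. -/
lemma delProb_K2_anti (p : E → R) (hp : IsProbVec p) (ends : E → Sym2 V) (a₂ o b : V) :
    Antitone (delProb p ends (K2ev ends a₂ o b)) := by
  have : delProb p ends (K2ev ends a₂ o b) =
      fun W => delClusterProb p ends a₂ {C : Set V | b ∈ C} (W ∪ (↑({o} : Finset V) : Set V)) := by
    funext W
    unfold delProb delClusterProb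
    congr 1
    ext ω
    simp only [Set.mem_setOf_eq, K2ev, delConfig_delConfig]
  rw [this]
  intro W W' h
  exact delClusterProb_anti p hp ends a₂ (fun _ _ h hx => h hx) (Set.union_subset_union_left _ h)

omit [Fintype V] [DecidableEq V] in
/-- `0 ≤ delProb`. -/
lemma delProb_nonneg (p : E → R) (hp : IsProbVec p) (ends : E → Sym2 V) (A : Set (Config E))
    (W : Set V) : 0 ≤ delProb p ends A W := prob_nonneg hp _

omit [Fintype V] [DecidableEq V] in
/-- `delProb ≤ 1`. -/
lemma delProb_le_one (p : E → R) (hp : IsProbVec p) (ends : E → Sym2 V) (A : Set (Config E))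
    (W : Set V) : delProb p ends A W ≤ 1 := prob_le_one hp _

end OHN

end RowC1

end Summit.Ventures.PercRepro2
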